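import Summits.CriticalPhenomena.Ising3DConformalLimit.Theorems.PositivityBegetsConformalityExistsScaleCovariantLimitItemMaps
import Summits.CriticalPhenomena.Ising3DConformalLimit.Theorems.HyperoctahedralRPExistsScaleCovariantLimitSplitGlue
import Summits.CriticalPhenomena.Ising3DConformalLimit.Theorems.HyperoctahedralRPExistsScaleCovariantLimitFoldedCurrentEngineIffDoubling
import HarnessLib

/-!
# Line `exact-split` — crux `ExistsScaleCovariantLimit` (item stmt-CriticalPhenomena-1981), route `PositivityBegetsConformality`

Strategist line (crux-strategist r1, 2026-08-17; RESTATED re-exam / BC2 REDIRECT of the route's deciding crux).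
The crux — existence of the full scale-covariant continuum limit of the critical `ℤ³` Ising correlators, without rotations —
is, kernel-checked, EXACTLY the conjunction of two existing ledger items
(`FoldedCurrentRepulsion.crux_iff_doubling_and_totallyDisconnected`, p139907):

* **stub 1 = item stmt-CriticalPhenomena-6150** `MirrorHoelderCompactness.TwoPointDoubling` — all-scale doubling of the axial
  critical two-point function (Aizenman–Duminil-Copin, Ann. Math. 194 (2021), Remark 5.10; open in every `d ≥ 3` for the
  nearest-neighbour model): the COMPACTNESS half (⟺ `MonotoneRG.OrbitPrecompact`, item 5955; ⟺ the lead's F2 `WallRepulsion`,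
  `wallRepulsion_iff_twoPointDoubling`, p138231);
* **stub 2 = item stmt-CriticalPhenomena-4659** `ClusterRigidity.ClusterSetTotallyDisconnected` — the cluster set of the pinned
  zoom is totally disconnected: the IDENTIFICATION half (under compactness ⟺ uniqueness of the cluster point,
  `clusterPointUnique_iff_clusterSetTotallyDisconnected`).

Both stubs are stated as the items' HOME decls VERBATIM (no costume, no re-typing), so that (i) the pieces of the decomposition
are literally the two open items with their own crux chains and registered birth skeletons
(`Cruxes/TwoPointDoubling/Lines/birth.lean`, `Cruxes/ClusterSetTotallyDisconnected/Lines/birth.lean`), and (ii) the composition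
below is a LANDED theorem: `PositivityBegetsConformalityMaps.crux_of_doubling_of_totallyDisconnected` (p144658) at this route's
copy BY NAME, `SplitGlue.hrp_crux_of_doubling_of_totallyDisconnected` at the `HyperoctahedralRP` copy (the registry's crux decl).
Difference to the lead's line `folded-current-repulsion` (v9, lead c18): same mathematics, F2 re-typed from `WallRepulsion` to the
item it is equivalent to, the c18 order-two sub-goals (§5/§6 there, not used by any composition) left out — so the registered
stub set is exactly the split family {6150, 4659} of the route (`route edit --split ExistsScaleCovariantLimit`), k = 2.

The assembly is NOT a trivial seam: `crux_iff_doubling_and_totallyDisconnected` (p139907, ~300 lines over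
`…CruxIffOrbitPrecompactPointwiseLimit`, `…CompactnessItemMapsDoubling`, `…FoldedCurrentUniqueness{,ClusterSet,LevelDistances,
ScaleRedundancy}`) makes the pieces INTERACT — total disconnectedness yields a unique cluster point only under the compactness
that doubling supplies (MMS sandwich + equicontinuity ⇒ Arzelà–Ascoli), and compactness + uniqueness give full-filter convergence
and then scale covariance by the Cauchy functional equation (`…ScaleCovariantOfTwoThree`, `…PinnedLimitOfDyadic`).

References: H. Duminil-Copin, Proc. ICM 2022, §8.4 p. 29 [DuminilCopinICM2022]; M. Aizenman, H. Duminil-Copin, Ann. of Math. 194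
(2021) = arXiv:1912.07973, Remark 5.10 [AizenmanDuminilCopinAnnals2021]; S. Rychkov, arXiv:2007.14315, p. 8 [Rychkov2020].
-/

namespace Summit.CriticalPhenomena.Ising3DConformalLimit.Cruxes.ExistsScaleCovariantLimit.ExactSplit

open Summit.CriticalPhenomena.Ising3DConformalLimit.Theses
open Summit.CriticalPhenomena.Ising3DConformalLimit.Cruxes.ExistsScaleCovariantLimit

/-! ## §1 Registered stubs — the two split children, items 6150 and 4659 VERBATIM -/

/-- **stub 1 = item stmt-CriticalPhenomena-6150** (compactness half; open, own crux chain `Cruxes/TwoPointDoubling`). -/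
theorem stub_twoPointDoubling : MirrorHoelderCompactness.TwoPointDoubling := by
  sorry

/-- **stub 2 = item stmt-CriticalPhenomena-4659** (identification half; open, own crux chain `Cruxes/ClusterSetTotallyDisconnected`). -/
theorem stub_clusterSetTotallyDisconnected : ClusterRigidity.ClusterSetTotallyDisconnected := by
  sorry

/-! ## §2 Composition — the crux BY NAME at route PositivityBegetsConformality's copy (landed theorem p144658) -/

/-- **COMPOSITION.** `TwoPointDoubling → ClusterSetTotallyDisconnected → PositivityBegetsConformality.ExistsScaleCovariantLimit`
— the landed `PositivityBegetsConformalityMaps.crux_of_doubling_of_totallyDisconnected` (p144658), i.e. the `←` half of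
`crux_iff_doubling_and_totallyDisconnected` (p139907) at this route's copy. -/
theorem ExistsScaleCovariantLimit_of :
    MirrorHoelderCompactness.TwoPointDoubling → ClusterRigidity.ClusterSetTotallyDisconnected →
      Summit.CriticalPhenomena.Ising3DConformalLimit.Theses.PositivityBegetsConformality.ExistsScaleCovariantLimit :=
  PositivityBegetsConformalityMaps.crux_of_doubling_of_totallyDisconnected

/-- The crux at this route's copy from the two registered stubs (closed modulo exactly items 6150 and 4659). -/
theorem ExistsScaleCovariantLimit_proof :
    Summit.CriticalPhenomena.Ising3DConformalLimit.Theses.PositivityBegetsConformality.ExistsScaleCovariantLimit :=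
  ExistsScaleCovariantLimit_of stub_twoPointDoubling stub_clusterSetTotallyDisconnected

/-! ## §3 The other route copies of the shared decl (one body; `δ`-unfolding) -/

/-- Composition at the `HyperoctahedralRP` copy — the landed ACYCLIC curried glue `SplitGlue.hrp_crux_of_doubling_of_totallyDisconnected`
(the `--glue-by` of the route split on PositivityBegetsConformality). -/
theorem ExistsScaleCovariantLimit_of_hrp :
    MirrorHoelderCompactness.TwoPointDoubling → ClusterRigidity.ClusterSetTotallyDisconnected →
      Summit.CriticalPhenomena.Ising3DConformalLimit.Theses.HyperoctahedralRP.ExistsScaleCovariantLimit :=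
  SplitGlue.hrp_crux_of_doubling_of_totallyDisconnected

/-- The `HyperoctahedralRP` copy from the stubs. -/
theorem ExistsScaleCovariantLimit_proof_hrp :
    Summit.CriticalPhenomena.Ising3DConformalLimit.Theses.HyperoctahedralRP.ExistsScaleCovariantLimit :=
  ExistsScaleCovariantLimit_proof

/-! ## §4 Exactness and the dictionary to the lead's line -/

/-- **EXACTNESS at this route's copy**: crux ⟺ stub 1 ∧ stub 2 (p144658 / p139907) — neither stub is dispensable, and a
refutation of either refutes the crux (`PositivityBegetsConformalityMaps.not_crux_of_not_twoPointDoubling`, `…_not_totallyDisconnected`). -/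
theorem ExistsScaleCovariantLimit_iff_stubs :
    Summit.CriticalPhenomena.Ising3DConformalLimit.Theses.PositivityBegetsConformality.ExistsScaleCovariantLimit ↔
      MirrorHoelderCompactness.TwoPointDoubling ∧ ClusterRigidity.ClusterSetTotallyDisconnected :=
  PositivityBegetsConformalityMaps.pbc_crux_iff_doubling_and_totallyDisconnected

/-- **Dictionary to line `folded-current-repulsion`**: its engine F2 `WallRepulsion` IS stub 1 (p138231). -/
theorem wallRepulsion_iff_stub_twoPointDoubling :
    FoldedCurrentRepulsion.WallRepulsion ↔ MirrorHoelderCompactness.TwoPointDoubling :=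
  FoldedCurrentRepulsion.wallRepulsion_iff_twoPointDoubling

end Summit.CriticalPhenomena.Ising3DConformalLimit.Cruxes.ExistsScaleCovariantLimit.ExactSplit
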